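import Mathlib
import Summits.MatrixMultiplication.MatrixMultiplication.Theorems.FourierTwoFamiliesModPPrimeCyclicPowerGainThetaPrelim

/-!
# `ϑ`-HalfDensity: the theta body of the frozen-difference conflict graph obeys the `L²` bound

Crux `stmt-MatrixMultiplication-14309` (`FourierTwoFamiliesModP.PrimeCyclicPowerGain`), line
`clique-coclique-direct-sum-clique`, first milestone of the registered stub `stub_thetaBound` (the line
card's paper lemma "ϑ-HalfDensity", here with a square-root-free real proof); closes the registered
milestone stub `stub_thetaHalfDensity` (bookkeeping in the sibling file `…ThetaPrelim`).

Setting.  `G` a finite additive commutative group (the stub: `G = ZMod p`), vertices `v = (v.1, v.2)` =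
pairs of finite subsets ("blocks"), a kernel `B : V → V → ℝ` that is symmetric, positive semidefinite as a
real quadratic form, of trace `1`, and SUPPORTED on pairs of admissible vertices (`|v.1| = |v.2| = s`,
clause (W) for `v`, `v.1 − v.2 ⊆ X₀`) that are equal or compatible (both cross-difference sets avoid `X₀`) —
exactly the hypotheses of `stub_thetaBound` minus invariance, nonnegativity and dominance, which are not
needed.  CONCLUSION (`two_mul_sq_mul_value_le`): `2 · s² · Σ_{v,w} B v w ≤ |G| · (s + 1)` for `s ≥ 1`.
So the relaxation reproduces the route's support `HalfDensity` (`2 n s² ≤ |H| (s+1)`, the whole `L²` level)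
for FRACTIONAL families; the bet `stub_thetaBound` is precisely "beat this by a power of `s`".

Proof (all sums finite, no characters, no spectral theorem).  With
`rep v w x = #{(a,b) ∈ v.1 × w.2 : a − b = x}`, `F(x) = Σ_{v,w} B_vw rep v w x`, `Δ(x) = Σ_v B_vv rep v v x`,
`X = Σ B`: (0) `0 ≤ Δ ≤ 1` pointwise ((W) makes `rep v v ≤ 1`; diagonal of a PSD kernel is `≥ 0`) and
`Σₓ Δ = s²`; (1) `F·Δ = Δ·Δ` pointwise (a compatible off-diagonal pair represents only differences OFF `X₀`,
while `Δ` lives ON `X₀`); (2) `F(x) ≥ 2s²X/|G| − s` pointwise: split each indicator into mean `s/|G|` plus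
fluctuation, the mean part gives `s²X/|G|`, the mixed parts vanish, and the fluctuation part is
`≥ −½(P_A + P_B)` by the polarisation inequality `−(uBu + u'Bu') ≤ 2uBu'` (sibling file `…ThetaPrelim`), where
`P_A = Σ_{v,w} B_vw (|v.1 ∩ w.1| − s²/|G|) = s − s²X/|G|` because compatible blocks have DISJOINT `A`-sides
(and `P_B` likewise); (3) `s² ≥ Σ Δ² = Σ FΔ ≥ (2s²X/|G| − s)·s²`.
-/

namespace Summit.MatrixMultiplication.MatrixMultiplication.Theorems.PrimeCyclicPowerGainTheta.HalfDensity

open scoped BigOperators Pointwise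
open Summit.MatrixMultiplication.MatrixMultiplication.Theorems.PrimeCyclicPowerGainTheta

variable {G : Type*} [AddCommGroup G] [Fintype G] [DecidableEq G]

/-! ### Step 0: the diagonal part `Δ` -/

/-- `0 ≤ Δ(x)`: diagonal entries of a PSD kernel and representation counts are nonnegative. -/
theorem delta_nonneg (B : Finset G × Finset G → Finset G × Finset G → ℝ)
    (hpsd : ∀ x : Finset G × Finset G → ℝ, 0 ≤ ∑ v, ∑ w, x v * B v w * x w) (x : G) :
    0 ≤ ∑ v, B v v * ∑ a ∈ v.1, ∑ b ∈ v.2, (if a - b = x then (1 : ℝ) else 0) :=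
  Finset.sum_nonneg fun v _ =>
    mul_nonneg (Kernel.diag_nonneg_of_psd B hpsd v) (Rep.rep_nonneg v v x)

/-- `Δ(x) ≤ 1`: clause (W) on the support of the diagonal and trace `1`. -/
theorem delta_le_one (B : Finset G × Finset G → Finset G × Finset G → ℝ)
    (hpsd : ∀ x : Finset G × Finset G → ℝ, 0 ≤ ∑ v, ∑ w, x v * B v w * x w)
    (hW : ∀ v : Finset G × Finset G, B v v ≠ 0 →
      ∀ a ∈ v.1, ∀ a' ∈ v.1, ∀ b ∈ v.2, ∀ b' ∈ v.2, (a - a') + (b - b') = 0 → a = a' ∧ b = b')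
    (htr : ∑ v, B v v = 1) (x : G) :
    ∑ v, B v v * ∑ a ∈ v.1, ∑ b ∈ v.2, (if a - b = x then (1 : ℝ) else 0) ≤ 1 := by
  calc ∑ v, B v v * ∑ a ∈ v.1, ∑ b ∈ v.2, (if a - b = x then (1 : ℝ) else 0)
      ≤ ∑ v, B v v := by
        apply Finset.sum_le_sum
        intro v _
        by_cases h : B v v = 0
        · simp [h]
        · calc B v v * ∑ a ∈ v.1, ∑ b ∈ v.2, (if a - b = x then (1 : ℝ) else 0)
              ≤ B v v * 1 :=
                mul_le_mul_of_nonneg_left (Rep.rep_le_one_of_direct v (hW v h) x)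
                  (Kernel.diag_nonneg_of_psd B hpsd v)
            _ = B v v := mul_one _
    _ = 1 := htr

/-- `Σₓ Δ(x) = s²`: every diagonal block in the support is balanced of size `s`, trace `1`. -/
theorem sum_delta (s : ℕ) (B : Finset G × Finset G → Finset G × Finset G → ℝ)
    (hcard : ∀ v : Finset G × Finset G, B v v ≠ 0 → v.1.card = s ∧ v.2.card = s)
    (htr : ∑ v, B v v = 1) :
    ∑ x, ∑ v, B v v * ∑ a ∈ v.1, ∑ b ∈ v.2, (if a - b = x then (1 : ℝ) else 0) = (s : ℝ) ^ 2 := by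
  rw [Finset.sum_comm]
  have h : ∀ v ∈ (Finset.univ : Finset (Finset G × Finset G)),
      ∑ x, B v v * ∑ a ∈ v.1, ∑ b ∈ v.2, (if a - b = x then (1 : ℝ) else 0) = B v v * (s : ℝ) ^ 2 := by
    intro v _
    rw [← Finset.mul_sum, Rep.sum_rep]
    by_cases hv : B v v = 0
    · simp [hv]
    · rw [(hcard v hv).1, (hcard v hv).2]; ring
  rw [Finset.sum_congr rfl h, ← Finset.sum_mul, htr, one_mul]

/-! ### Step 1: orthogonality of the off-diagonal part to `Δ` -/

/-- `F(x)·Δ(x) = Δ(x)·Δ(x)`: if `Δ(x) ≠ 0` then `x ∈ X₀` (matched differences), and then every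
off-diagonal term `B v w · rep v w x` vanishes because compatible cross differences avoid `X₀`. -/
theorem F_mul_delta_eq (X₀ : Finset G) (B : Finset G × Finset G → Finset G × Finset G → ℝ)
    (hD : ∀ v : Finset G × Finset G, B v v ≠ 0 → v.1 - v.2 ⊆ X₀)
    (hX : ∀ v w : Finset G × Finset G, B v w ≠ 0 → v ≠ w → Disjoint (v.1 - w.2) X₀) (x : G) :
    (∑ v, ∑ w, B v w * ∑ a ∈ v.1, ∑ b ∈ w.2, (if a - b = x then (1 : ℝ) else 0)) *
        (∑ u, B u u * ∑ a ∈ u.1, ∑ b ∈ u.2, (if a - b = x then (1 : ℝ) else 0)) =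
      (∑ v, B v v * ∑ a ∈ v.1, ∑ b ∈ v.2, (if a - b = x then (1 : ℝ) else 0)) *
        (∑ u, B u u * ∑ a ∈ u.1, ∑ b ∈ u.2, (if a - b = x then (1 : ℝ) else 0)) := by
  by_cases hΔ : (∑ u, B u u * ∑ a ∈ u.1, ∑ b ∈ u.2, (if a - b = x then (1 : ℝ) else 0)) = 0
  · rw [hΔ, mul_zero, mul_zero]
  · -- some diagonal block represents `x`, hence `x ∈ X₀`
    obtain ⟨u, -, hu⟩ := Finset.exists_ne_zero_of_sum_ne_zero hΔ
    have hBu : B u u ≠ 0 := fun h => hu (by rw [h, zero_mul])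
    have hru : ∑ a ∈ u.1, ∑ b ∈ u.2, (if a - b = x then (1 : ℝ) else 0) ≠ 0 :=
      fun h => hu (by rw [h, mul_zero])
    have hx : x ∈ X₀ := hD u hBu (Rep.mem_sub_of_rep_ne_zero u u x hru)
    congr 1
    apply Finset.sum_congr rfl
    intro v _
    rw [Finset.sum_eq_single v]
    · intro w _ hwv
      by_cases hB : B v w = 0
      · rw [hB, zero_mul]
      · have hdis := hX v w hB (Ne.symm hwv)
        by_cases hr : ∑ a ∈ v.1, ∑ b ∈ w.2, (if a - b = x then (1 : ℝ) else 0) = 0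
        · rw [hr, mul_zero]
        · exact absurd hx (Finset.disjoint_left.1 hdis (Rep.mem_sub_of_rep_ne_zero v w x hr))
    · intro h; exact absurd (Finset.mem_univ v) h

/-! ### Step 2: the pointwise lower bound on `F` (bookkeeping in `…ThetaPrelim`) -/

/-- **Pointwise lower bound** `F(x) ≥ 2 s² X / |G| − s` for a symmetric PSD trace-one kernel whose support
consists of balanced blocks of size `s` with pairwise disjoint `A`-sides and pairwise disjoint `B`-sides. -/
theorem F_lower (s : ℕ) (B : Finset G × Finset G → Finset G × Finset G → ℝ)
    (hsymm : ∀ v w, B v w = B w v)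
    (hpsd : ∀ x : Finset G × Finset G → ℝ, 0 ≤ ∑ v, ∑ w, x v * B v w * x w)
    (hc : ∀ v w : Finset G × Finset G, B v w ≠ 0 →
      v.1.card = s ∧ v.2.card = s ∧ w.1.card = s ∧ w.2.card = s)
    (hdA : ∀ v w : Finset G × Finset G, B v w ≠ 0 → v ≠ w → Disjoint v.1 w.1)
    (hdB : ∀ v w : Finset G × Finset G, B v w ≠ 0 → v ≠ w → Disjoint v.2 w.2)
    (htr : ∑ v, B v v = 1) (x : G) :
    2 * (s : ℝ) ^ 2 * (∑ v, ∑ w, B v w) / (Fintype.card G : ℝ) - (s : ℝ) ≤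
      ∑ v, ∑ w, B v w * ∑ a ∈ v.1, ∑ b ∈ w.2, (if a - b = x then (1 : ℝ) else 0) := by
  have hN : (0 : ℝ) < Fintype.card G := by exact_mod_cast Fintype.card_pos
  set N : ℝ := (Fintype.card G : ℝ) with hNdef
  set X : ℝ := ∑ v, ∑ w, B v w with hXdef
  -- indicators, means, fluctuations
  set fA : Finset G × Finset G → G → ℝ := fun v y => if y ∈ v.1 then 1 else 0 with hfA
  set gB : Finset G × Finset G → G → ℝ := fun w z => if z ∈ w.2 then 1 else 0 with hgB
  set cA : Finset G × Finset G → ℝ := fun v => (v.1.card : ℝ) / N with hcA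
  set cB : Finset G × Finset G → ℝ := fun w => (w.2.card : ℝ) / N with hcB
  set ft : Finset G × Finset G → G → ℝ := fun v y => fA v y - cA v with hft
  set gt : Finset G × Finset G → G → ℝ := fun w z => gB w z - cB w with hgt
  rw [Fluct.F_eq_sum B x]
  change 2 * (s : ℝ) ^ 2 * X / N - (s : ℝ) ≤ ∑ y, ∑ v, ∑ w, fA v y * B v w * gB w (y - x)
  -- the four-term expansion
  have hsplit : ∑ y, ∑ v, ∑ w, fA v y * B v w * gB w (y - x) =
      ∑ _y : G, ∑ v, ∑ w, cA v * B v w * cB w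
      + ∑ y, ∑ v, ∑ w, cA v * B v w * gt w (y - x)
      + ∑ y, ∑ v, ∑ w, ft v y * B v w * cB w
      + ∑ y, ∑ v, ∑ w, ft v y * B v w * gt w (y - x) := by
    simp only [← Finset.sum_add_distrib]
    apply Finset.sum_congr rfl; intro y _
    apply Finset.sum_congr rfl; intro v _
    apply Finset.sum_congr rfl; intro w _
    simp only [hft, hgt]; ring
  -- T1 = s² X / N
  have hT1 : ∑ _y : G, ∑ v, ∑ w, cA v * B v w * cB w = (s : ℝ) ^ 2 * X / N := by
    rw [Finset.sum_const, Finset.card_univ, nsmul_eq_mul]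
    have : ∑ v, ∑ w, cA v * B v w * cB w = ∑ v, ∑ w, B v w * ((s : ℝ) ^ 2 / N ^ 2) := by
      apply Finset.sum_congr rfl; intro v _
      apply Finset.sum_congr rfl; intro w _
      by_cases hB : B v w = 0
      · rw [hB]; ring
      · obtain ⟨h1, -, -, h4⟩ := hc v w hB
        simp only [hcA, hcB, h1, h4]; ring
    rw [this]
    simp only [← Finset.sum_mul]
    rw [← hXdef, ← hNdef]
    field_simp
  -- T2 = 0
  have hT2 : ∑ y, ∑ v, ∑ w, cA v * B v w * gt w (y - x) = 0 := by
    rw [Finset.sum_comm]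
    apply Finset.sum_eq_zero; intro v _
    rw [Finset.sum_comm]
    apply Finset.sum_eq_zero; intro w _
    rw [← Finset.mul_sum, Rep.sum_sub_arg (fun z => gt w z) x]
    have : ∑ z, gt w z = 0 := by simp only [hgt, hgB, hcB]; exact Rep.sum_fluct w.2
    rw [this, mul_zero]
  -- T3 = 0
  have hT3 : ∑ y, ∑ v, ∑ w, ft v y * B v w * cB w = 0 := by
    rw [Finset.sum_comm]
    apply Finset.sum_eq_zero; intro v _
    rw [Finset.sum_comm]
    apply Finset.sum_eq_zero; intro w _
    have hre : ∀ y : G, ft v y * B v w * cB w = ft v y * (B v w * cB w) := fun y => by ring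
    rw [Finset.sum_congr rfl fun y _ => hre y, ← Finset.sum_mul]
    have : ∑ y, ft v y = 0 := by simp only [hft, hfA, hcA]; exact Rep.sum_fluct v.1
    rw [this, zero_mul]
  -- T4 ≥ -(P_A + P_B)/2
  have hPA : ∑ y, ∑ v, ∑ w, ft v y * B v w * ft w y = (s : ℝ) - (s : ℝ) ^ 2 / N * X := by
    have h := Fluct.fluctA_energy (G := G) s B (fun v w hB => ⟨(hc v w hB).1, (hc v w hB).2.2.1⟩) hdA
    rw [htr, mul_one] at h
    simp only [hft, hfA, hcA]
    exact h
  have hPB : ∑ y, ∑ v, ∑ w, gt v y * B v w * gt w y = (s : ℝ) - (s : ℝ) ^ 2 / N * X := by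
    have h := Fluct.fluctB_energy (G := G) s B (fun v w hB => ⟨(hc v w hB).2.1, (hc v w hB).2.2.2⟩) hdB
    rw [htr, mul_one] at h
    simp only [hgt, hgB, hcB]
    exact h
  have hT4 : -((s : ℝ) - (s : ℝ) ^ 2 / N * X) ≤ ∑ y, ∑ v, ∑ w, ft v y * B v w * gt w (y - x) := by
    have hpt : ∀ y : G, -((∑ v, ∑ w, ft v y * B v w * ft w y) +
        (∑ v, ∑ w, gt v (y - x) * B v w * gt w (y - x))) ≤
        2 * ∑ v, ∑ w, ft v y * B v w * gt w (y - x) := fun y =>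
      Kernel.neg_add_le_two_mul_cross_of_psd B hsymm hpsd (fun v => ft v y) (fun w => gt w (y - x))
    have hsum := Finset.sum_le_sum fun y (_ : y ∈ (Finset.univ : Finset G)) => hpt y
    rw [← Finset.mul_sum, Finset.sum_neg_distrib, Finset.sum_add_distrib, hPA,
      Rep.sum_sub_arg (fun z => ∑ v, ∑ w, gt v z * B v w * gt w z) x, hPB] at hsum
    linarith
  have e : (s : ℝ) ^ 2 / N * X = (s : ℝ) ^ 2 * X / N := by ring
  rw [e] at hT4
  have e2 : 2 * (s : ℝ) ^ 2 * X / N - (s : ℝ) = 2 * ((s : ℝ) ^ 2 * X / N) - (s : ℝ) := by ring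
  rw [e2, hsplit, hT1, hT2, hT3]
  linarith

/-! ### Step 3: assembly -/

/-- **`ϑ`-HalfDensity** (general finite abelian group).  For `s ≥ 1`, every symmetric PSD trace-one kernel
on block pairs whose nonzero entries sit on pairs of admissible (`|v.1| = |v.2| = s`, (W), `v.1 − v.2 ⊆ X₀`)
vertices that are equal or compatible (`(v.1 − w.2) ∩ X₀ = ∅ = (w.1 − v.2) ∩ X₀`) has value
`Σ_{v,w} B v w ≤ |G| (s+1) / (2 s²)`.  Invariance, entrywise nonnegativity and diagonal dominance (the other
hypotheses of `stub_thetaBound`) are not used. -/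
theorem two_mul_sq_mul_value_le (s : ℕ) (hs : 1 ≤ s) (X₀ : Finset G)
    (B : Finset G × Finset G → Finset G × Finset G → ℝ)
    (hsymm : ∀ v w, B v w = B w v)
    (hpsd : ∀ x : Finset G × Finset G → ℝ, 0 ≤ ∑ v, ∑ w, x v * B v w * x w)
    (hsupp : ∀ v w : Finset G × Finset G, B v w ≠ 0 →
      (v.1.card = s ∧ v.2.card = s ∧
        (∀ a ∈ v.1, ∀ a' ∈ v.1, ∀ b ∈ v.2, ∀ b' ∈ v.2, (a - a') + (b - b') = 0 → a = a' ∧ b = b') ∧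
        v.1 - v.2 ⊆ X₀) ∧
      (w.1.card = s ∧ w.2.card = s ∧
        (∀ a ∈ w.1, ∀ a' ∈ w.1, ∀ b ∈ w.2, ∀ b' ∈ w.2, (a - a') + (b - b') = 0 → a = a' ∧ b = b') ∧
        w.1 - w.2 ⊆ X₀) ∧
      (v = w ∨ (Disjoint (v.1 - w.2) X₀ ∧ Disjoint (w.1 - v.2) X₀)))
    (htr : ∑ v, B v v = 1) :
    2 * (s : ℝ) ^ 2 * ∑ v, ∑ w, B v w ≤ (Fintype.card G : ℝ) * ((s : ℝ) + 1) := by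
  have hN : (0 : ℝ) < Fintype.card G := by exact_mod_cast Fintype.card_pos
  have hs' : (0 : ℝ) < s := by exact_mod_cast hs
  -- derived support facts
  have hW : ∀ v : Finset G × Finset G, B v v ≠ 0 →
      ∀ a ∈ v.1, ∀ a' ∈ v.1, ∀ b ∈ v.2, ∀ b' ∈ v.2, (a - a') + (b - b') = 0 → a = a' ∧ b = b' :=
    fun v h => (hsupp v v h).1.2.2.1
  have hcard : ∀ v : Finset G × Finset G, B v v ≠ 0 → v.1.card = s ∧ v.2.card = s :=
    fun v h => ⟨(hsupp v v h).1.1, (hsupp v v h).1.2.1⟩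
  have hD : ∀ v : Finset G × Finset G, B v v ≠ 0 → v.1 - v.2 ⊆ X₀ := fun v h => (hsupp v v h).1.2.2.2
  have hX : ∀ v w : Finset G × Finset G, B v w ≠ 0 → v ≠ w → Disjoint (v.1 - w.2) X₀ :=
    fun v w h hvw => ((hsupp v w h).2.2.resolve_left hvw).1
  have hc : ∀ v w : Finset G × Finset G, B v w ≠ 0 →
      v.1.card = s ∧ v.2.card = s ∧ w.1.card = s ∧ w.2.card = s :=
    fun v w h => ⟨(hsupp v w h).1.1, (hsupp v w h).1.2.1, (hsupp v w h).2.1.1, (hsupp v w h).2.1.2.1⟩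
  have hdA : ∀ v w : Finset G × Finset G, B v w ≠ 0 → v ≠ w → Disjoint v.1 w.1 := by
    intro v w h hvw
    obtain ⟨⟨_, hv2, _, hvD⟩, _, hcomp⟩ := hsupp v w h
    have hdis := (hcomp.resolve_left hvw).2
    rw [Finset.disjoint_left]
    intro a hav haw
    have hne : v.2.Nonempty := by rw [← Finset.card_pos, hv2]; exact hs
    obtain ⟨b, hb⟩ := hne
    have h1 : a - b ∈ X₀ := hvD (Finset.sub_mem_sub hav hb)
    exact Finset.disjoint_left.1 hdis (Finset.sub_mem_sub haw hb) h1
  have hdB : ∀ v w : Finset G × Finset G, B v w ≠ 0 → v ≠ w → Disjoint v.2 w.2 := by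
    intro v w h hvw
    obtain ⟨⟨hv1, _, _, hvD⟩, _, hcomp⟩ := hsupp v w h
    have hdis := (hcomp.resolve_left hvw).1
    rw [Finset.disjoint_left]
    intro b hbv hbw
    have hne : v.1.Nonempty := by rw [← Finset.card_pos, hv1]; exact hs
    obtain ⟨a, ha⟩ := hne
    have h1 : a - b ∈ X₀ := hvD (Finset.sub_mem_sub ha hbv)
    exact Finset.disjoint_left.1 hdis (Finset.sub_mem_sub ha hbw) h1
  -- the chain  (2s²X/N − s)·s² ≤ Σ FΔ = Σ Δ² ≤ Σ Δ = s²
  set Δ : G → ℝ := fun x => ∑ v, B v v * ∑ a ∈ v.1, ∑ b ∈ v.2, (if a - b = x then (1 : ℝ) else 0)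
    with hΔ
  set F : G → ℝ := fun x => ∑ v, ∑ w, B v w * ∑ a ∈ v.1, ∑ b ∈ w.2, (if a - b = x then (1 : ℝ) else 0)
    with hF
  have hΔsum : ∑ x, Δ x = (s : ℝ) ^ 2 := sum_delta s B hcard htr
  have hlow : (2 * (s : ℝ) ^ 2 * (∑ v, ∑ w, B v w) / (Fintype.card G : ℝ) - (s : ℝ)) * (s : ℝ) ^ 2 ≤
      ∑ x, F x * Δ x := by
    calc (2 * (s : ℝ) ^ 2 * (∑ v, ∑ w, B v w) / (Fintype.card G : ℝ) - (s : ℝ)) * (s : ℝ) ^ 2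
        = (2 * (s : ℝ) ^ 2 * (∑ v, ∑ w, B v w) / (Fintype.card G : ℝ) - (s : ℝ)) * ∑ x, Δ x := by
          rw [hΔsum]
      _ = ∑ x, (2 * (s : ℝ) ^ 2 * (∑ v, ∑ w, B v w) / (Fintype.card G : ℝ) - (s : ℝ)) * Δ x :=
          Finset.mul_sum _ _ _
      _ ≤ ∑ x, F x * Δ x := by
          apply Finset.sum_le_sum
          intro x _
          exact mul_le_mul_of_nonneg_right (F_lower s B hsymm hpsd hc hdA hdB htr x)
            (delta_nonneg B hpsd x)
  have hmid : ∑ x, F x * Δ x = ∑ x, Δ x * Δ x :=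
    Finset.sum_congr rfl fun x _ => F_mul_delta_eq X₀ B hD hX x
  have hup : ∑ x, Δ x * Δ x ≤ (s : ℝ) ^ 2 := by
    calc ∑ x, Δ x * Δ x ≤ ∑ x, Δ x := by
          apply Finset.sum_le_sum
          intro x _
          calc Δ x * Δ x ≤ Δ x * 1 :=
                mul_le_mul_of_nonneg_left (delta_le_one B hpsd hW htr x) (delta_nonneg B hpsd x)
            _ = Δ x := mul_one _
      _ = (s : ℝ) ^ 2 := hΔsum
  have key : (2 * (s : ℝ) ^ 2 * (∑ v, ∑ w, B v w) / (Fintype.card G : ℝ) - (s : ℝ)) * (s : ℝ) ^ 2 ≤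
      1 * (s : ℝ) ^ 2 := by rw [one_mul]; linarith
  have key2 : 2 * (s : ℝ) ^ 2 * (∑ v, ∑ w, B v w) / (Fintype.card G : ℝ) - (s : ℝ) ≤ 1 :=
    le_of_mul_le_mul_right key (by positivity)
  rw [sub_le_iff_le_add, div_le_iff₀ hN] at key2
  linarith

/-- **Registered milestone stub `stub_thetaHalfDensity` — `ϑ`-HalfDensity in `ZMod p`** (crux
stmt-MatrixMultiplication-14309, line clique-coclique-direct-sum-clique; milestone 1 of the bet `stub_thetaBound`,
its calibration in its own terms): with the stub's vertex type `Finset (ZMod p) × Finset (ZMod p)` and its support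
hypothesis verbatim, every symmetric PSD trace-one kernel has `2 s² · Σ_{v,w} B v w ≤ p (s + 1)`, i.e. value
`≤ p(s+1)/(2s²)` — the route's `HalfDensity` level, reproduced by the relaxation for fractional families. -/
theorem stub_thetaHalfDensity :
    ∀ (p : ℕ) [NeZero p] (s : ℕ), 1 ≤ s → ∀ (X₀ : Finset (ZMod p))
      (B : Finset (ZMod p) × Finset (ZMod p) → Finset (ZMod p) × Finset (ZMod p) → ℝ),
      (∀ v w, B v w = B w v) →
      (∀ x : Finset (ZMod p) × Finset (ZMod p) → ℝ, 0 ≤ ∑ v, ∑ w, x v * B v w * x w) →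
      (∀ v w : Finset (ZMod p) × Finset (ZMod p), B v w ≠ 0 →
        (v.1.card = s ∧ v.2.card = s ∧
          (∀ a ∈ v.1, ∀ a' ∈ v.1, ∀ b ∈ v.2, ∀ b' ∈ v.2, (a - a') + (b - b') = 0 → a = a' ∧ b = b') ∧
          v.1 - v.2 ⊆ X₀) ∧
        (w.1.card = s ∧ w.2.card = s ∧
          (∀ a ∈ w.1, ∀ a' ∈ w.1, ∀ b ∈ w.2, ∀ b' ∈ w.2, (a - a') + (b - b') = 0 → a = a' ∧ b = b') ∧
          w.1 - w.2 ⊆ X₀) ∧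
        (v = w ∨ (Disjoint (v.1 - w.2) X₀ ∧ Disjoint (w.1 - v.2) X₀))) →
      ∑ v, B v v = 1 →
      2 * (s : ℝ) ^ 2 * ∑ v, ∑ w, B v w ≤ (p : ℝ) * ((s : ℝ) + 1) := by
  intro p _ s hs X₀ B hsymm hpsd hsupp htr
  have h := two_mul_sq_mul_value_le s hs X₀ B hsymm hpsd hsupp htr
  rwa [ZMod.card p] at h

end Summit.MatrixMultiplication.MatrixMultiplication.Theorems.PrimeCyclicPowerGainTheta.HalfDensity
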